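import Summits.BirchSwinnertonDyer.BirchSwinnertonDyer.Theorems.ByReductionTypeAtTwoOrdKatoHalfAtTwoIsoCoreTheoremATwoResidue
import HarnessLib

/-!
# Route ByReductionTypeAtTwo, crux `OrdKatoHalfAtTwoIso` (stmt-BirchSwinnertonDyer-19573), line
# `steinberg-fibre-at-two`: SOCKET 2 RE-CUT TO ITS `μ`-PART — Kato's zeta classes in Coleman coordinates at `p = 2`
# (Theorems-side definitions, displayed by name, and the KERNEL chain «re-cut socket ⇒ μ(X(E/ℚ_∞)) = 0 ⇒ the crux»)

Seat `cruxlead-stmt-BirchSwinnertonDyer-19573-g4` (LEAD PROVER, MODE LINE; HOME `run/shared/lean/pub/bsd-2adic/`;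
`--supports` stmt-BirchSwinnertonDyer-23760 `OrdKatoFineZetaAtTwoResidue`). HONEST FRAMING (cell bsd-2adic): BSD is not
proved by any of this; the crux `OrdKatoHalfAtTwoIso` is NOT proved here; the two definitions below are OPEN statements
DISPLAYED BY NAME (memo-tier readings of Kato §§12–17 at `2`), nothing is asserted about them, and every theorem that
mentions the crux, the residue binder or `μ = 0` is CONDITIONAL on the displayed binders it names. Pattern of the line's
binder file `…OrdKatoHalfAtTwoIsoSteinbergDefs.lean` (p655368: definitions + the kernel composition in one module).

WHY THIS FILE (kernel audit of the line's closing cone, lead g4). The registered socket 2 of the line,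
`SteinbergFibreAtTwo.DivisibilityInputsFineZetaAtTwoResidue` (= K4 child crux stmt-BirchSwinnertonDyer-23760
`OrdKatoFineZetaAtTwoResidue`, VERBATIM), asks for Kato's FULL §17.13 package `Kato2004.DivisibilityInputs W 2 f κ γ I D`
at `p = 2` on the DD12 residue. The only consumer of that socket in the tree, `mu_eq_zero_on_residue_of_sockets`
(p655368; and through it `ordKatoHalfDD12ResidueTwo_of_sockets` / `ordKatoHalfAtTwoIso_of_sockets` / p669276
`ordKatoHalfAtTwoIso_of_memo_cite` / p676232), reads from the package `K` ONLY: the Coleman image `col (loc Z) ⊆ Λ` of the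
zeta submodule `Z ⊆ 𝐇¹` (through `col_injective`, one half of `exact_P`, and `image_zeta_localized` AT THE SINGLE
PRIME `𝔭 = (2)`), the map `P → X` with the fine quotient `π : X ↠ X₀` exact after it, and the span clause over genuine
`2`-adic Euler-system classes. It never reads `finite_H2`, `isTorsion_H2`, `δ`, `ε`, `exact_X`, `exact_H2` (the
(17.13.1) clauses printed for `p ≠ 2`), `loc_injective` ((17.13.2)), `finite_H2loc` ((17.13.4)), `finite_coker_col`
(Prop. 17.11), `n`, `G`, `ιG_eq`, `pow_mem` (Thm. 16.6 (2) + 12.6), `es_bound` (Thm. 12.5 (3) via 13.4 (2)), `integral`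
(Thm. 12.5 (4), vacuous on the residue), nor `image_zeta_localized` at the height-one primes `𝔭 ∌ 2` — the crux takes its
`λ`-side from PRINT (Kato 17.4 (1)(2) at `2`, the route's PUB item) and needs the socket only for `μ(X(E/ℚ_∞)) = 0`.
Moreover `ρ_{W,2^∞}` NOT onto is used only to derive `Δ_W < 0` (socket 1, PROVED p669276, is stated for `ρ̄₂` onto and
`Δ < 0`; socket 3, PROVED p642753, for `ρ̄₂` onto alone). Hence socket 2 can be RE-CUT to the strictly smaller
reading below, on the larger habitat «`ρ̄_{W,2}` onto, `Δ_W < 0`» (the DD12 residue ∪ the `Δ < 0` half of B8's habitat):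

* `HasZetaColemanMuInputsAtTwo W f κ γ hκ D Y` — **per datum** (§1): pinned `𝐇¹`, zeta submodule `Z` inside the span of
  GENUINE `2`-adic classes, an ideal `P ⊆ Λ` (Coleman image of `H¹_s`, 17.11), `ℓ : 𝐇¹ → P`, `τ : P → X` killing `ℓ(Z)`
  with image `ker (π : X ↠ X₀)`, and at `𝔭 = (2)` ONLY: `s ∉ (2)` with `s·G₁ ∈ ℓ(Z)` for every integral `G₁`,
  `ι G₁ = L₂(f, α)` (p. 280 via 16.6 + 17.11 + the period unit `ord₂ ϖ = 0`, Abbes–Ullmo at the good prime `2`).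
* `ZetaColemanMuInputsNegDiscAtTwo` — **[MEMO tier, OPEN] the re-cut SOCKET 2** (§2): the per-datum statement for every
  globally minimal `W`, good ordinary at `2`, `ρ̄_{W,2}` onto, `Δ_W < 0`, newform `f`, cyclotomic `(κ, γ)`, all `D`, `Y`.
  Socket 2's `¬CM` binder is dropped (it guarded only 13.4 (v) for the dropped field `es_bound`, MEMO-5′ R0/R5; on
  «ordinary at `2`, `ρ̄₂` onto» CM is impossible anyway — CM field `ℚ(√−7)`, rational `2`-torsion). Keyed to the same
  cell delta-memo MEMO-5′ @c7235a6f37ab26bc (F2 at `P`, F4, F5/F8 at `(2)`, conjuncts; R1 needs only `Δ < 0`, R2/R4 only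
  `E[2]` irreducible; `ρ_{2^∞}` not onto served there ONLY to void `integral`, absent here). A READING of Kato at `2`,
  NOT in print as stated; NOT a Literature fact; nothing asserted.

THE KERNEL CHAIN (§§3–5 below):
* `hasZetaColemanMuInputsAtTwo_of_divisibilityInputs` — a package `K : Kato2004.DivisibilityInputs W 2 f κ γ I D` with the
  socket-2 conjuncts yields `HasZetaColemanMuInputsAtTwo W f κ γ hκ D Y` (`P := range col`, `ℓ := col ∘ loc`,
  `τ := toX ∘ col⁻¹`; image clause = `K.image_zeta_localized` at `(2)`): the registered socket (child 23760 as filed)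
  implies the re-cut one datum by datum; the converse is NOT claimed.
* `mu_eq_zero_of_hasZetaColemanMuInputsAtTwo` — KERNEL modulo the per-datum reading: `μ(D.X) = 0` for `W` good ordinary
  at `2`, `ρ̄₂` onto, `Δ < 0` — the bookkeeping of `mu_eq_zero_on_residue_of_sockets` on the lighter inputs (INT2-AUTO;
  socket 3 PROVED p642753; image clause ⇒ zeta class `∉ 2·𝐇¹`; span clause ⇒ genuine class `∉ 2·𝐇¹`; socket 1 PROVED
  p669276 ⇒ `length_(2) X₀ = 0`; `length_(2) X ≤ length_(2)(P/ℓZ) + length_(2) X₀ = 0` as `P/ℓZ ↪ Λ/ℓ(Z) ∋ s·G₁ ∉ (2)`).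
* `…_of_zetaColemanMuInputsNegDiscAtTwo` (`mu_eq_zero`, `katoMuPartAtTwo`, `mainConjectureLowerDivisibilityAtTwoOrd`) — the
  ∀-forms on the habitat, the last adding Abbes–Ullmo BY NAME (p654400) and Kato 17.4 (1)(2) at `2` (`h17`).
* `katoIntAtGoodOrdSurjectiveTwo_of_negDisc_of_zetaColemanMu` — on the `Δ < 0` HALF of B8's habitat (`ρ_{W,2^∞}` onto)
  B8's conclusion already follows from the re-cut socket + Abbes–Ullmo + Kato 17.4 (1)(2): the line needs B8
  (`KatoIntAtGoodOrdSurjectiveTwo`, stmt-23762) only for `Δ > 0` (MEMO-6).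
* `ordKatoHalfDD12ResidueTwo_of_zetaColemanMu`, `ordKatoHalfAtTwoIso_of_zetaColemanMu{,_cite}` — the residue binder and
  **the crux BY NAME** from the re-cut socket, Abbes–Ullmo, B7, B8 and Kato 17.4 (1)(2) at `2` / the PUB item (axioms of
  the door: propext, Classical.choice, Quot.sound).

References: [Kato2004Asterisque] 12.6, (14.9.3), 16.6, 17.11, §17.13; [MazurTateTeitelbaum1986Invent] §I.12; [AbbesUllmo1996]
Thm A; [DokchitserDokchitserMathZ2012]; MEMO-5 / MEMO-5′ (HOME); `…OrdKatoHalfAtTwoIsoSteinbergDefs.lean` (p655368).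
-/

set_option autoImplicit false
set_option linter.dupNamespace false

noncomputable section

open scoped Classical MatrixGroups ModularForm NumberField
open CongruenceSubgroup WeierstrassCurve Field IsDedekindDomain
open Literature.NumberTheory.GaloisRepresentations
open Literature.NumberTheory.EllipticCurves Literature.NumberTheory.EllipticCurves.ModularForms
open Literature.NumberTheory.EllipticCurves.Kato2004
  Literature.NumberTheory.EllipticCurves.Kato2004.EulerSystemValues
open Literature.NumberTheory.EllipticCurves.Rank1Residual
open Summit.BirchSwinnertonDyer.BirchSwinnertonDyer.Theorems.Rank1ResidualX1Defs
  Summit.BirchSwinnertonDyer.BirchSwinnertonDyer.Rank1Residual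
open Summit.BirchSwinnertonDyer.Rank1Residual Summit.BirchSwinnertonDyer.Rank1Residual.X5
open Summit.BirchSwinnertonDyer.BirchSwinnertonDyer.Theorems.OrdKatoOptimalAtTwo
  Summit.BirchSwinnertonDyer.BirchSwinnertonDyer.Theorems.OrdKatoIntAtTwo
open Summit.BirchSwinnertonDyer.BirchSwinnertonDyer.Theses.ByReductionTypeAtTwo

namespace Summit.BirchSwinnertonDyer.BirchSwinnertonDyer.Theorems.SteinbergFibreAtTwo

/-! ## §1 Kato's zeta classes in Coleman coordinates at `2` — the `μ`-part inputs, per datum -/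

/-- **Kato's zeta classes in Coleman coordinates at `p = 2`, the `μ`-part inputs for ONE curve and ONE pair of
data `(D, Y)`** (a reading; nothing asserted): there are a pinned Iwasawa cohomology `I` (`𝐇¹ = 𝐇¹_Γ(T₂W)`), a
`Λ`-submodule `Z ⊆ 𝐇¹` contained in the `Λ`-span of GENUINE `2`-adic Euler-system classes
(`IsEulerSystemClassTwo`; Thm. 12.6 span clause), an ideal `P ⊆ Λ = ℤ₂⟦T⟧` (the Coleman image of `H¹_s`,
Prop. 17.11), `Λ`-maps `ℓ : 𝐇¹ → P` (Coleman map after localisation at `2`) and `τ : P → X(E/ℚ_∞)` with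
`τ (ℓ z) = 0` for `z ∈ Z` (half of the exactness of (17.13.1) at `P`), and the fine quotient
`π : X(E/ℚ_∞) ↠ X₀(E/ℚ_∞)` ((14.9.3)), surjective and exact after `τ`, such that for every `G₁ ∈ Λ` with
`ι G₁ = L₂(f, α)` some `s ∉ (2)` satisfies `s·G₁ ∈ ℓ(Z)` (p. 280 at the prime `(2)`: explicit reciprocity 16.6,
17.11 and the `2`-adic period unit). Exactly the part of `Kato2004.DivisibilityInputs` (+ the socket-2 conjuncts)
that the residue argument `mu_eq_zero_on_residue_of_sockets` reads. OPEN per datum (a memo-tier reading at `2`);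
nothing asserted.
[cite: Kato2004Asterisque, Thm. 12.6 (p. 222), (14.9.3) (p. 240), Thm. 16.6 (p. 271), Prop. 17.11 (p. 277), §17.13 (p. 280) (shape only; nothing asserted)] -/
@[conjecture] def HasZetaColemanMuInputsAtTwo (W : WeierstrassCurve ℚ) [W.IsElliptic] [W.IsGloballyMinimal]
    [ContinuousSMul ℤ_[2] (W.tateModule 2)] [Module.Free ℤ_[2] (W.tateModule 2)]
    [Module.Finite ℤ_[2] (W.tateModule 2)] {N : ℕ} (f : CuspForm (Gamma0 N) 2)
    (κ : ZpExtension ℚ 2) (γ : absoluteGaloisGroup ℚ) (hκ : κ.IsCyclotomic)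
    (D : W.SelmerDualData κ γ) (Y : W.FineSelmerDualData κ γ) : Prop :=
  ∃ (I : IwasawaH1Data W 2 κ γ) (Z : Submodule (IwasawaAlgebra 2) I.H)
    (P : Submodule (IwasawaAlgebra 2) (IwasawaAlgebra 2))
    (ℓ : I.H →ₗ[IwasawaAlgebra 2] P) (τ : P →ₗ[IwasawaAlgebra 2] D.X)
    (π : D.X →ₗ[IwasawaAlgebra 2] Y.X),
    Z ≤ Submodule.span (IwasawaAlgebra 2) {s : I.H | IsEulerSystemClassTwo W hκ I s} ∧
    (∀ z ∈ Z, τ (ℓ z) = 0) ∧ Function.Surjective π ∧ Function.Exact τ π ∧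
    ∀ G₁ : IwasawaAlgebra 2,
      iwasawaToPowerSeries 2 G₁ = padicLFunction f (unitRoot W 2 : ℚ_[2]) →
        ∃ s : IwasawaAlgebra 2, s ∉ IwasawaAlgebra.augIdealP 2 ∧
          s * G₁ ∈ Submodule.map (P.subtype ∘ₗ ℓ) Z

/-! ## §2 The re-cut SOCKET 2 of the line, displayed by name -/

/-- [MEMO tier, OPEN] **SOCKET 2 of line `steinberg-fibre-at-two`, RE-CUT TO ITS `μ`-PART (lead g4)**: for every
globally minimal `W`, good ordinary at `2`, `ρ̄_{W,2}` onto `GL₂(𝔽₂)` (so `E[2]` is irreducible; no `¬CM` binder —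
it guarded only the dropped field `es_bound`, and CM is impossible on this habitat) and
`Δ_W < 0` (the DD12 residue «`ρ_{W,2^∞}` not onto» is the part of this habitat cut out by Dokchitser–Dokchitser;
the rest is the `Δ < 0` half of the surjective-image habitat of B8), its newform `f`, the cyclotomic `(κ, γ)`:
every Selmer dual datum `D` and fine Selmer dual datum `Y` carry Kato's zeta classes in Coleman coordinates at `2`
(`HasZetaColemanMuInputsAtTwo`). Field-wise WEAKER than the registered socket `DivisibilityInputsFineZetaAtTwoResidue`
(kernel: `hasZetaColemanMuInputsAtTwo_of_divisibilityInputs`) — no `𝐇²`, no (17.13.1) exactness at `X`/`𝐇²`, no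
(17.13.2), no 17.11 finite cokernel, no 16.6 (2) membership, no 12.5 (3)/(4), no statement at the primes `𝔭 ∌ 2`.
Keyed to the cell delta-memo MEMO-5′ @c7235a6f37ab26bc (F2 at `P`, F4, F5/F8 at `(2)`, conjuncts; R1 needs `Δ < 0`,
R2/R4 `E[2]` irreducible). A READING of Kato §§12–17 at `2`, NOT in print as stated; NOT a Literature fact;
nothing asserted.
[cite: Kato2004Asterisque, Thm. 12.6 (p. 222), (14.9.3) (p. 240), Thm. 16.6 (p. 271), Prop. 17.11 (p. 277), §17.13 (pp. 279–280) (shape only; nothing asserted)] -/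
@[conjecture] def ZetaColemanMuInputsNegDiscAtTwo : Prop :=
  ∀ (W : WeierstrassCurve ℚ) [W.IsElliptic] [W.IsGloballyMinimal]
    [ContinuousSMul ℤ_[2] (W.tateModule 2)] [Module.Free ℤ_[2] (W.tateModule 2)]
    [Module.Finite ℤ_[2] (W.tateModule 2)] {N : ℕ} [NeZero N] (f : CuspForm (Gamma0 N) 2)
    (κ : ZpExtension ℚ 2) (γ : absoluteGaloisGroup ℚ) (hκ : κ.IsCyclotomic),
    IsOrdinaryAt W 2 → W.HasSurjectiveModNGaloisRep 2 → W.Δ < 0 →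
    κ.IsTopGenerator γ → IsCyclotomicVariable 2 γ → IsNewformOf W f →
    ∀ (D : W.SelmerDualData κ γ) (Y : W.FineSelmerDualData κ γ),
      HasZetaColemanMuInputsAtTwo W f κ γ hκ D Y

/-- `ZetaColemanMuInputsNegDiscAtTwo` unfolds to its displayed body. [folklore] -/
theorem zetaColemanMuInputsNegDiscAtTwo_iff : ZetaColemanMuInputsNegDiscAtTwo ↔
    ∀ (W : WeierstrassCurve ℚ) [W.IsElliptic] [W.IsGloballyMinimal]
      [ContinuousSMul ℤ_[2] (W.tateModule 2)] [Module.Free ℤ_[2] (W.tateModule 2)]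
      [Module.Finite ℤ_[2] (W.tateModule 2)] {N : ℕ} [NeZero N] (f : CuspForm (Gamma0 N) 2)
      (κ : ZpExtension ℚ 2) (γ : absoluteGaloisGroup ℚ) (hκ : κ.IsCyclotomic),
      IsOrdinaryAt W 2 → W.HasSurjectiveModNGaloisRep 2 → W.Δ < 0 →
      κ.IsTopGenerator γ → IsCyclotomicVariable 2 γ → IsNewformOf W f →
      ∀ (D : W.SelmerDualData κ γ) (Y : W.FineSelmerDualData κ γ),
        HasZetaColemanMuInputsAtTwo W f κ γ hκ D Y :=
  Iff.rfl

/-! ## §3 Per datum: registered socket ⇒ re-cut socket, and re-cut socket ⇒ `μ = 0` -/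

section PerDatum

variable {W : WeierstrassCurve ℚ} [W.IsElliptic] [W.IsGloballyMinimal]
  [ContinuousSMul ℤ_[2] (W.tateModule 2)] [Module.Free ℤ_[2] (W.tateModule 2)]
  [Module.Finite ℤ_[2] (W.tateModule 2)] {N : ℕ} {f : CuspForm (Gamma0 N) 2}
  {κ : ZpExtension ℚ 2} {γ : absoluteGaloisGroup ℚ} {hκ : κ.IsCyclotomic}
  {D : W.SelmerDualData κ γ} {Y : W.FineSelmerDualData κ γ}

/-- **The registered socket 2 implies the re-cut socket, datum by datum (KERNEL).** Given Kato's full §17.13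
package `K : DivisibilityInputs W 2 f κ γ I D` at `2` together with the socket-2 conjuncts — the fine quotient
`π : X ↠ X₀` surjective and exact after `K.toX`, and `K.Z` inside the span of genuine `2`-adic Euler-system classes —
and `E[2]` irreducible, the Coleman-coordinate `μ`-inputs hold: `P := range K.col ⊆ Λ`, `ℓ := K.col ∘ K.loc`,
`τ := K.toX ∘ K.col⁻¹`, and the image clause is `K.image_zeta_localized` at the prime `(2)`. Nothing else of `K`
is used. [cite: Kato2004Asterisque, §17.13 (pp. 279–280) and Prop. 17.11 (p. 277)] -/
theorem hasZetaColemanMuInputsAtTwo_of_divisibilityInputs {I : IwasawaH1Data W 2 κ γ}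
    (K : DivisibilityInputs W 2 f κ γ I D) (π : D.X →ₗ[IwasawaAlgebra 2] Y.X)
    (hπs : Function.Surjective π) (hπ : Function.Exact K.toX π)
    (hZ : K.Z ≤ Submodule.span (IwasawaAlgebra 2) {s : I.H | IsEulerSystemClassTwo W hκ I s})
    (hirr : W.HasIrreducibleModPGaloisRep 2) :
    HasZetaColemanMuInputsAtTwo W f κ γ hκ D Y := by
  let e : K.P ≃ₗ[IwasawaAlgebra 2] LinearMap.range K.col := LinearEquiv.ofInjective K.col K.col_injective
  have he : ∀ x : K.P, e.symm (K.col.rangeRestrict x) = x := fun x => by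
    rw [LinearEquiv.symm_apply_eq]
    ext
    simp [e, LinearEquiv.ofInjective_apply]
  refine ⟨I, K.Z, LinearMap.range K.col, K.col.rangeRestrict ∘ₗ K.loc, K.toX ∘ₗ e.symm.toLinearMap, π,
    hZ, ?_, hπs, ?_, ?_⟩
  · intro z _
    change K.toX (e.symm (K.col.rangeRestrict (K.loc z))) = 0
    rw [he]
    exact (K.exact_P (K.loc z)).mpr ⟨z, rfl⟩
  · rw [LinearMap.exact_iff] at hπ ⊢
    rw [hπ, LinearMap.range_comp_of_range_eq_top _ e.symm.range]
  · intro G₁ hG₁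
    let 𝔭 : PrimeSpectrum (IwasawaAlgebra 2) :=
      ⟨IwasawaAlgebra.augIdealP 2, IwasawaAlgebra.isPrime_augIdealP_holds 2⟩
    obtain ⟨s, hs, hsG, -⟩ :=
      K.image_zeta_localized hirr G₁ hG₁ 𝔭 (by exact IwasawaAlgebra.height_augIdealP_holds 2)
    refine ⟨s, hs, ?_⟩
    have hcomp : (LinearMap.range K.col).subtype ∘ₗ (K.col.rangeRestrict ∘ₗ K.loc) = K.col ∘ₗ K.loc := by
      ext z
      rfl
    rwa [hcomp]

/-- **`μ(X(E/ℚ_∞)) = 0` from Kato's zeta classes in Coleman coordinates at `2` (KERNEL modulo the per-datum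
reading), for `W` good ordinary at `2` with `ρ̄_{W,2}` onto `GL₂(𝔽₂)` and `Δ_W < 0`.** Chain: INT2-AUTO gives
`G₁ ∈ Λ` with `ι G₁ = L₂(f, α)`; socket 3 (analytic `μ₂ = 0`, PROVED) gives `G₁ ∉ (2)`; the image clause gives
`s ∉ (2)` with `s·G₁ ∈ ℓ(Z)`, hence a zeta class `z ∈ Z` with `z ∉ 2·𝐇¹` (else `ℓ(Z) ⊆ (2)`), hence by the span
clause a GENUINE `2`-adic Euler-system class `∉ 2·𝐇¹`; socket 1 (`coreTheoremATwoResidue_holds`, PROVED) then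
kills the `E[2]`-lifts of `Sel₀(E/ℚ_∞)` by `T^J`, so `X₀/2X₀` is finite and `length_(2) X₀ = 0`; finally
`length_(2) X ≤ length_(2) (P/ℓZ) + length_(2) X₀` (`τ` kills `ℓZ`, `π` exact after `τ`) and
`length_(2) (P/ℓZ) = 0` (`P/ℓZ ↪ Λ/ℓ(Z)`, and `ℓ(Z) ⊄ (2)` as it contains `s·G₁`).
[cite: Kato2004Asterisque, Thm. 12.6 (p. 222), (14.9.3) (p. 240), §17.13 (pp. 279–280)]
[cite: MazurTateTeitelbaum1986Invent, §I.12] -/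
theorem mu_eq_zero_of_hasZetaColemanMuInputsAtTwo [NeZero N] (hgo : GoodOrd W 2)
    (h2 : W.HasSurjectiveModNGaloisRep 2) (hΔ : W.Δ < 0) (hf : IsNewformOf W f)
    (hγ : κ.IsTopGenerator γ) (h : HasZetaColemanMuInputsAtTwo W f κ γ hκ D Y) : D.mu = 0 := by
  have hord : IsOrdinaryAt W 2 := ⟨hgo.1, hgo.2⟩
  haveI : NeZero ((2 : ℕ) : ℚ) := ⟨by norm_num⟩
  -- `X(E/ℚ_∞)` is finitely generated over `Λ` for the cyclotomic `κ` (PROVED in the tree, Nakayama)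
  haveI : Module.Finite (IwasawaAlgebra 2) D.X :=
    WeierstrassCurve.SelmerDualData.module_finite_of_isCyclotomic W κ hκ D hγ
  obtain ⟨I, Z, P, ℓ, τ, π, hZ, hτℓ, hπs, hπ, himg⟩ := h
  haveI : Module.Finite (IwasawaAlgebra 2) Y.X := Module.Finite.of_surjective π hπs
  -- `L₂(f, α) ∈ ι(Λ)` (INT2-AUTO, PROVED) and socket 3 (PROVED): `G₁ ∉ (2)`
  obtain ⟨G₁, hG₁⟩ := exists_iwasawaToPowerSeries_eq_padicLFunction_two_auto (W := W) (f := f) hord hf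
  have hμL : G₁ ∉ IwasawaAlgebra.augIdealP 2 :=
    not_mem_augIdealP_of_norm_coeff_eq_one hG₁
      (AnalyticMuTwo.exists_norm_coeff_padicLFunction_two_eq_one_of_surj W hgo h2 hf)
  -- the image clause at `(2)`: `s ∉ (2)`, `s·G₁ ∈ ℓ(Z)`
  obtain ⟨s, hs, hsG⟩ := himg G₁ hG₁
  -- hence some zeta class `z ∈ Z` is not divisible by `2` in `𝐇¹` …
  have hz : ∃ z ∈ Z, z ∉ IwasawaAlgebra.augIdealP 2 • (⊤ : Submodule (IwasawaAlgebra 2) I.H) := by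
    by_contra hcon
    push Not at hcon
    have hZle : Z ≤ IwasawaAlgebra.augIdealP 2 • (⊤ : Submodule (IwasawaAlgebra 2) I.H) :=
      fun z hz => hcon z hz
    have hsub : Submodule.map (P.subtype ∘ₗ ℓ) Z ≤
        (IwasawaAlgebra.augIdealP 2 • ⊤ : Submodule (IwasawaAlgebra 2) (IwasawaAlgebra 2)) :=
      (Submodule.map_mono hZle).trans
        (by rw [Submodule.map_smul'']; exact Submodule.smul_mono le_rfl le_top)
    have htop : (IwasawaAlgebra.augIdealP 2 • ⊤ : Submodule (IwasawaAlgebra 2) (IwasawaAlgebra 2)) =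
        IwasawaAlgebra.augIdealP 2 := by
      rw [Ideal.smul_eq_mul, Ideal.mul_top]
    have hsG' : s * G₁ ∈ IwasawaAlgebra.augIdealP 2 := by rw [← htop]; exact hsub hsG
    rcases (IwasawaAlgebra.isPrime_augIdealP_holds 2).mem_or_mem hsG' with h' | h'
    · exact hs h'
    · exact hμL h'
  obtain ⟨z, hzZ, hz2⟩ := hz
  -- … and by the span clause some GENUINE `2`-adic Euler-system class is not divisible by `2`
  obtain ⟨s', hs', hs'p⟩ := exists_mem_not_mem_of_le_span hZ hzZ hz2
  -- socket 1 (PROVED): a power of `T` kills the `E[2]`-lifts of `Sel₀`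
  obtain ⟨J, hJ⟩ := coreTheoremATwoResidue_holds W κ γ I hκ hgo.1 hgo.2 h2 hΔ hγ ⟨s', hs', hs'p⟩
  haveI : Finite (Y.X ⧸ (IwasawaAlgebra.augIdealP 2 • (⊤ : Submodule (IwasawaAlgebra 2) Y.X))) :=
    Y.finite_quotient_augIdealP_of_finite_pTorsion
      (W.finite_fineSelmerInfty_pTorsion_of_forall_iterate_eq_zero κ hγ hJ)
  -- bookkeeping at `𝔭 = (2)`
  let 𝔭 : PrimeSpectrum (IwasawaAlgebra 2) :=
    ⟨IwasawaAlgebra.augIdealP 2, IwasawaAlgebra.isPrime_augIdealP_holds 2⟩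
  have hY0 : Module.lengthAt (IwasawaAlgebra 2) Y.X 𝔭 = 0 :=
    KatoMuSkeleton.lengthAt_eq_zero_of_finite_quotient_p (M := Y.X) 𝔭 rfl
  have hX0 : Module.lengthAt (IwasawaAlgebra 2) D.X 𝔭 = 0 := by
    set LZ : Submodule (IwasawaAlgebra 2) P := Submodule.map ℓ Z with hLZ
    set M : Ideal (IwasawaAlgebra 2) := Submodule.map P.subtype LZ with hM
    have hM_eq : Submodule.map (P.subtype ∘ₗ ℓ) Z = M := by
      rw [hM, hLZ, Submodule.map_comp]
    have hsGM : s * G₁ ∈ M := hM_eq ▸ hsG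
    have hnot : ¬ M ≤ 𝔭.asIdeal := fun hle => by
      rcases 𝔭.isPrime.mem_or_mem (hle hsGM) with h' | h'
      · exact hs h'
      · exact hμL h'
    have hΛM : Module.lengthAt (IwasawaAlgebra 2) (IwasawaAlgebra 2 ⧸ M) 𝔭 = 0 :=
      Module.lengthAt_quotient_eq_zero_of_not_le hnot
    have hPLZ : Module.lengthAt (IwasawaAlgebra 2) (P ⧸ LZ) 𝔭 = 0 := by
      refine le_antisymm ?_ bot_le
      rw [← hΛM]
      refine Module.lengthAt_le_of_injective (Submodule.mapQ LZ M P.subtype fun y hy => ⟨y, hy, rfl⟩) ?_ 𝔭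
      rw [← LinearMap.ker_eq_bot, Submodule.ker_mapQ, hM,
        Submodule.comap_map_eq_of_injective P.injective_subtype, Submodule.mkQ_map_self]
    have hle : LZ ≤ LinearMap.ker τ := by
      rintro _ ⟨x, hx, rfl⟩
      exact hτℓ x hx
    let f' : (P ⧸ LZ) →ₗ[IwasawaAlgebra 2] D.X := LZ.liftQ τ hle
    have hf' : Function.Exact f' π := by
      rw [LinearMap.exact_iff, Submodule.range_liftQ]
      exact LinearMap.exact_iff.mp hπ
    refine le_antisymm ?_ bot_le
    calc Module.lengthAt (IwasawaAlgebra 2) D.X 𝔭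
        ≤ Module.lengthAt (IwasawaAlgebra 2) (P ⧸ LZ) 𝔭 + Module.lengthAt (IwasawaAlgebra 2) Y.X 𝔭 :=
          Module.lengthAt_le_add_of_exact f' π hf' 𝔭
      _ = 0 := by rw [hPLZ, hY0, zero_add]
  change muInvariant 2 D.X = 0
  rw [muInvariant_eq_toNat_lengthAt 2 D.X 𝔭 rfl, hX0]
  rfl

end PerDatum

/-! ## §4 The ∀-forms on the habitat «good ordinary at `2`, `ρ̄₂` onto, `Δ < 0`» -/

section Habitat

variable (W : WeierstrassCurve ℚ) [W.IsElliptic] [W.IsGloballyMinimal]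

/-- **`μ(X(E/ℚ_∞)) = 0` for every cyclotomic Selmer dual datum, modulo the re-cut socket 2**, for every
globally minimal `W`, good ordinary at `2`, `ρ̄_{W,2}` onto, `Δ_W < 0`, and every newform `f` of it (the structure
facts of `T₂W` and the fine datum `Y` are supplied by tree theorems). Conditional on the displayed binder only.
[cite: Kato2004Asterisque, §17.13 (pp. 279–280)] [cite: GreenbergLNM1716, Conj. 1.11 (p. 64) (shape)] -/
theorem mu_eq_zero_of_zetaColemanMuInputsNegDiscAtTwo (hF : ZetaColemanMuInputsNegDiscAtTwo)
    (hgo : GoodOrd W 2) (h2 : W.HasSurjectiveModNGaloisRep 2) (hΔ : W.Δ < 0)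
    {N : ℕ} [NeZero N] (f : CuspForm (Gamma0 N) 2) (hf : IsNewformOf W f)
    (κ : ZpExtension ℚ 2) (γ : absoluteGaloisGroup ℚ) (hκ : κ.IsCyclotomic) (hγ : κ.IsTopGenerator γ)
    (hγ' : IsCyclotomicVariable 2 γ) (D : W.SelmerDualData κ γ) : D.mu = 0 := by
  haveI : ContinuousSMul ℤ_[2] (W.tateModule 2) := TateModule.continuousSMul_padicInt
  haveI : Module.Free ℤ_[2] (W.tateModule 2) := W.module_free_tateModule_holds 2
  haveI : Module.Finite ℤ_[2] (W.tateModule 2) := W.module_finite_tateModule_holds 2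
  obtain ⟨Y⟩ := W.nonempty_fineSelmerDualData κ hγ
  exact mu_eq_zero_of_hasZetaColemanMuInputsAtTwo hgo h2 hΔ hf hγ
    (hF W f κ γ hκ ⟨hgo.1, hgo.2⟩ h2 hΔ hγ hγ' hf D Y)

/-- **`O1.KatoMuPartAtTwo W` on the habitat modulo the re-cut socket** (`μ = 0` ⇒ `2^{μ(X)} = 1 ∣ L₀`).
[cite: GreenbergLNM1716, Conj. 1.11 (p. 64) (shape)] -/
theorem katoMuPartAtTwo_of_zetaColemanMuInputsNegDiscAtTwo (hF : ZetaColemanMuInputsNegDiscAtTwo)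
    (hgo : GoodOrd W 2) (h2 : W.HasSurjectiveModNGaloisRep 2) (hΔ : W.Δ < 0) :
    O1.KatoMuPartAtTwo W := by
  intro κ γ hκ hγ hγ' _ _ f hf ϖ _ D L₀ _
  rw [mu_eq_zero_of_zetaColemanMuInputsNegDiscAtTwo W hF hgo h2 hΔ f hf κ γ hκ hγ hγ' D, pow_zero, map_one]
  exact one_dvd _

/-- **Kato's lower divisibility `X5.O1.MainConjectureLowerDivisibilityAtTwoOrd W` AT the curve, on the whole habitat
«good ordinary at `2`, `ρ̄₂` onto, `Δ < 0`», modulo the re-cut socket, Abbes–Ullmo BY NAME (`ord₂ ϖ = 0` on the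
`E[2]`-irreducible good locus, p654400) and Kato 17.4 (1)(2) at `2` for `W` (`h17`, PRINT)** — through the cell's
`O1.mainConjectureLowerDivisibilityAtTwoOrd_of_katoMuPartAtTwo`.
[cite: Kato2004Asterisque, Thm. 17.4 (1)(2) (p. 273)] [cite: AbbesUllmo1996, Thm. A] -/
theorem mainConjectureLowerDivisibilityAtTwoOrd_of_zetaColemanMuInputsNegDiscAtTwo
    (hF : ZetaColemanMuInputsNegDiscAtTwo) (hAU : abbesUllmo_not_dvd_maninConstant_of_not_dvd_level)
    (hgo : GoodOrd W 2) (h2 : W.HasSurjectiveModNGaloisRep 2) (hΔ : W.Δ < 0)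
    (h17 : ∀ [NeZero (W.conductorNorm ℤ)] (f : CuspForm (Gamma0 (W.conductorNorm ℤ)) 2),
      kato_divisibility_allPrimes W 2 (f := f)) :
    O1.MainConjectureLowerDivisibilityAtTwoOrd W := by
  haveI : NeZero ((2 : ℕ) : ℚ) := ⟨by norm_num⟩
  exact O1.mainConjectureLowerDivisibilityAtTwoOrd_of_katoMuPartAtTwo W h17
    (fun f hf ϖ hϖ => hint_two_of_abbesUllmo_of_irr hAU W hgo
      (hasIrreducibleModPGaloisRep_of_hasSurjectiveModNGaloisRep W 2 h2) f hf ϖ hϖ)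
    (katoMuPartAtTwo_of_zetaColemanMuInputsNegDiscAtTwo W hF hgo h2 hΔ)

end Habitat

/-! ## §5 Consequences BY NAME: the `Δ < 0` half of B8, the residue binder, the crux -/

/-- **The `Δ < 0` half of B8 from the re-cut socket**: modulo `ZetaColemanMuInputsNegDiscAtTwo`, Abbes–Ullmo BY NAME
and Kato 17.4 (1)(2) at `2`, every globally minimal `W`, good ordinary at `2`, with `ρ_{W,2^∞}` ONTO `GL₂(ℤ₂)` and
`Δ_W < 0` satisfies `X5.O1.MainConjectureLowerDivisibilityAtTwoOrd W` — B8's conclusion on the W_K2 Thm. B habitat; so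
the line needs B8 (`KatoIntAtGoodOrdSurjectiveTwo`) only for `Δ_W > 0` (MEMO-6). Conditional; nothing asserted about B8.
[cite: Kato2004Asterisque, Thm. 17.4 (1)(2) (p. 273)] [cite: AbbesUllmo1996, Thm. A] -/
theorem katoIntAtGoodOrdSurjectiveTwo_of_negDisc_of_zetaColemanMu
    (hF : ZetaColemanMuInputsNegDiscAtTwo) (hAU : abbesUllmo_not_dvd_maninConstant_of_not_dvd_level)
    (h17 : ∀ (V : WeierstrassCurve ℚ) [V.IsElliptic] [V.IsGloballyMinimal] [NeZero (V.conductorNorm ℤ)]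
      (f : CuspForm (Gamma0 (V.conductorNorm ℤ)) 2), kato_divisibility_allPrimes V 2 (f := f)) :
    ∀ (W : WeierstrassCurve ℚ) [W.IsElliptic] [W.IsGloballyMinimal],
      GoodOrd W 2 → O1.TwoAdicSurjective W → W.Δ < 0 → O1.MainConjectureLowerDivisibilityAtTwoOrd W := by
  intro W _ _ hgo him hΔ
  have h2 : W.HasSurjectiveModNGaloisRep 2 := by
    have h := him 1 one_pos
    rwa [pow_one] at h
  exact mainConjectureLowerDivisibilityAtTwoOrd_of_zetaColemanMuInputsNegDiscAtTwo W hF hAU hgo h2 hΔ (h17 W)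

/-- **The residue binder `OrdKatoHalfDD12ResidueTwo` from the re-cut socket**, Abbes–Ullmo BY NAME and Kato 17.4 (1)(2)
at `2` (`h17`): on the DD12 residue `ρ_{W,2^∞}` not onto gives `Δ_W < 0` (Dokchitser–Dokchitser, `Δ_neg_of_residue'`).
[cite: Kato2004Asterisque, Thm. 17.4 (1)(2) (p. 273)] [cite: DokchitserDokchitserMathZ2012, Theorem (p. 961)] -/
theorem ordKatoHalfDD12ResidueTwo_of_zetaColemanMu (hF : ZetaColemanMuInputsNegDiscAtTwo)
    (hAU : abbesUllmo_not_dvd_maninConstant_of_not_dvd_level)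
    (h17 : ∀ (V : WeierstrassCurve ℚ) [V.IsElliptic] [V.IsGloballyMinimal] [NeZero (V.conductorNorm ℤ)]
      (f : CuspForm (Gamma0 (V.conductorNorm ℤ)) 2), kato_divisibility_allPrimes V 2 (f := f)) :
    OrdKatoHalfDD12ResidueTwo := by
  intro W _ _ _ hgo h2 hns
  exact mainConjectureLowerDivisibilityAtTwoOrd_of_zetaColemanMuInputsNegDiscAtTwo W hF hAU hgo h2
    (Δ_neg_of_residue' W hgo h2 hns) (h17 W)

/-- **The crux `OrdKatoHalfAtTwoIso` (stmt-BirchSwinnertonDyer-19573) BY NAME from the RE-CUT socket 2**,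
Abbes–Ullmo (print, by name), B7, B8 (memo binders) and Kato 17.4 (1)(2) at `2` (`h17`) — one application of the
cell's door `ordKatoHalfAtTwoIso_of_binders`; socket 1 and socket 3 are PROVED and consumed inside. Conditional on the
displayed binders; nothing closed. [cite: Kato2004Asterisque, Thm. 17.4 (1)(2) (p. 273)] [cite: AbbesUllmo1996, Thm. A] -/
theorem ordKatoHalfAtTwoIso_of_zetaColemanMu (hF : ZetaColemanMuInputsNegDiscAtTwo)
    (hAU : abbesUllmo_not_dvd_maninConstant_of_not_dvd_level)
    (hB7 : KatoMuPartAtOptimalMemberOfNotSurjectiveTwo) (hB8 : KatoIntAtGoodOrdSurjectiveTwo)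
    (h17 : ∀ (V : WeierstrassCurve ℚ) [V.IsElliptic] [V.IsGloballyMinimal] [NeZero (V.conductorNorm ℤ)]
      (f : CuspForm (Gamma0 (V.conductorNorm ℤ)) 2), kato_divisibility_allPrimes V 2 (f := f)) :
    OrdKatoHalfAtTwoIso :=
  ordKatoHalfAtTwoIso_of_binders hB7 hB8 (ordKatoHalfDD12ResidueTwo_of_zetaColemanMu hF hAU h17) h17

/-- **The crux BY NAME from the re-cut socket and the route's by-name items** (Abbes–Ullmo, B7, B8, the PUB item
`OrdPublishedInputsAtTwo` — third conjunct = Kato 17.4 (1)(2) at `2`): the shape a split glue consumes once child 23760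
is re-typed. Conditional; nothing closed. [cite: Kato2004Asterisque, Thm. 17.4 (1)(2) (p. 273)] [cite: AbbesUllmo1996, Thm. A] -/
theorem ordKatoHalfAtTwoIso_of_zetaColemanMu_cite (hF : ZetaColemanMuInputsNegDiscAtTwo)
    (hAU : abbesUllmo_not_dvd_maninConstant_of_not_dvd_level)
    (hB7 : KatoMuPartAtOptimalMemberOfNotSurjectiveTwo) (hB8 : KatoIntAtGoodOrdSurjectiveTwo)
    (hPub : OrdPublishedInputsAtTwo) : OrdKatoHalfAtTwoIso := by
  obtain ⟨_, _, h17, _⟩ := hPub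
  exact ordKatoHalfAtTwoIso_of_zetaColemanMu hF hAU hB7 hB8 h17

end Summit.BirchSwinnertonDyer.BirchSwinnertonDyer.Theorems.SteinbergFibreAtTwo

end
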